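import Literature.MathematicalPhysics.QuantumFieldTheory.Balaban1983to89.B8IdxB8SubDRigidity
import Literature.MathematicalPhysics.QuantumFieldTheory.Balaban1983to89.B9SupplySockB9P3ZdFrame

/-!
# `Balaban1983to89.B8IdxB8SubDPrintClassGap` — [Balaban1985RegularSpaces] (1.3)–(1.4) p. 77 («Ω_j is a sum of cubes of a size M₁Lʲη, (Lʲη)⁻¹dist(Ω_jᶜ, Ω_{j+1}) > RM₁ …
# M₁ … is much bigger than δ₀⁻¹ … R is a sufficiently large positive integer (a power of L)») VERSUS THE (1.5)-KEYED LEAF INDEX OF RECORD `Node00.IdxB8SubD θ`: THE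
# TYPED INDEX IS STRICTLY WIDER THAN PRINT'S LITERAL (1.3)–(1.4) (`B8Eq134Admissible.Admissible134`) — and than [Balaban1984PropagatorsII] (2.2) (`Sep22Zd`) — FOR EVERY
# CHOICE OF PRINT'S CONSTANTS, witnessed by print's own Sect.-F tower (1.131) at the minimal margin the typed law admits; what the print class keeps

statement-level skeleton of published theorems with citation tags; proofs where landed; nothing here is a claim about the
Yang–Mills mass gap

[Balaban1985RegularSpaces] ("B8", CMP **99** (1985) 75–102): (1.3)–(1.5) p. 77, (1.131) p. 99, p. 98 («a distance between boundaries of these cubes is equal to R₁M₁Lʲη»);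
[B6] = [Balaban1984PropagatorsII] (2.1)–(2.2) p. 224; [4] = [Balaban1985BackgroundPropagators] Thm 3.1 p. 397 («… for M ≥ M₁ …»), Thm 3.3 p. 399.
CITATION HEADER (lean-in-tree rule).  Cell `pub-ymgap` (HUMAN RULING D-0062 ∕ D-0149 width seats), DAG node N05 = [B8]; width seat `pub-ymgap-dag-n05-w2` (g5), 2026-08-28;
bears on K1⁹ `stmt-QuantumFields-27364` (`--kind proof --supports`, helper; count-neutral).  APPEND-ONLY discipline: a NEW importing module; NOTHING in `B8IdxB8SubDRigidity`
(this seat g4), `Node00/CarriersB8SubD` (dag-n05-w1), `B8Eq134Admissible` (lit-balaban r13), `B8SectAStatements` ∕ `B8Eq131Cubes` ∕ `B8Eq131CubesAdmissible` (r05),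
`B9SupplySockB9P3ZdFrame` (dag-n06-e: `MemberZd`, `memZd`, `bigSideZd`, `Sep22Zd`) or below them is edited — everything is CONSUMED BY NAME.

WHY THIS FILE («LOCATED-PRINT-CLASS»).  This seat's g4 rigidity file certified one direction: the leaf index carries EXACTLY the `DomainSeq`-admissible `(η, k, Ω)`
(`exists_idxB8SubD_iff`) and every sequence admissible in PRINT's literal sense is carried (`exists_idxB8SubD_of_admissible134`) — «the typed index asks NO MORE than print's
(1.3)–(1.5)».  The CONVERSE is false, and this file makes it exact: `B8ConstraintBonds.DomainSeq` keeps of (1.4) only `Lʲ`-block saturation and a ONE-`L^{j+1}`-BLOCK collar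
(its own header: «used only through `RM₁ ≥ L`»), while print asks `M₁Lʲη`-cube saturation and an `RM₁Lʲη` collar, `M₁` «much bigger than δ₀⁻¹», `R` «a sufficiently large
power of L».  At print's own Sect.-F tower (1.131) the metric clause and [B6] (2.2) hold EXACTLY when the separation constant is at most the margin `ρ` (§1); the tower with
side `M = 1` and margin `ρ = L` — the least `cubeFam_domainSeq` admits — is a member of `IdxB8SubD θ` at every depth (g4 `exists_idxB8SubD_cubeFam`) at which print's
(1.3)–(1.4) holds exactly in the regime print EXCLUDES (`M₁ = 1 ∧ R ≤ L`).  WHAT IT BEARS ON: the five (1.5)-keyed [4]-type binder families of the N05 row of record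
(`SLet ∕ SLetUB ∕ SB9P ∕ SH59src ∕ SB9srcHP`, dag-n05-d p619291 ∕ dag-n05-w4 p625756; likewise `B9.Thm33Printed` at the `ℤᵈ` frame + the junction binders over
`j : IdxB8SubD θ`) quantify [4] Thms 3.1–3.3's CONCLUSIONS with member-independent constants over EVERY member of the index — hence over members OUTSIDE the hypothesis
class of the printed theorems (dag-n06-e's HONEST SCOPE (b) of `B9SupplySockB9P3ZdFrame`) and outside the regime `Sep22Zd R`, `R⌈M⌉ ≥ max(N₀, 3 log L ∕ κ₂)` of N06's
member-uniform suppliers (`B9Eq347GlobalFromLocalZdUniform`).  As typed, those binders are STRONGER-THAN-PRINT hypotheses; whether [4]'s bounds hold uniformly at one-block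
collars is NOT IN PRINT, and no landed member-UNIFORM supplier reaches the minimal tower (dag-n05-c g16 WORD-1 + correction, cell bus 2026-08-28 10:52Z ∕ 11:07Z: the
flat (1.59)♭ `B8Ineq159FlatCubeMemberTransplant.ineq159FlatCubeMemberPrinted_holds` needs `M ≥ 8L`, `ρ ≥ 2L²`; dag-n05-w3's PER-MEMBER `SB9P` certificate p627411 does reach
it, with member-dependent constants).  Two honest exits (the lane's ∕ NODE 00's word, not this seat's): DECLARE it in the binder docstrings (dag-n05-d g13: «CLASS NOTE» in
FILES C∕D, bus 11:12Z), or CUT the index to a supplier's class `κ` once N06 names it (§3: print's own class is inhabited at every depth).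

WHAT IS PROVED (0 sorry; proof lane — no `def`, no `instance`, no `notation`).  `Ωₘᵢₙ(L, k) := cubeFam true L (fun _ ↦ L + 1) 1 L k`.
* §1 PRINT'S SECT.-F TOWER `cubeFam true L a M ρ k`, ANY corner ∕ side ∕ margin (`L, ρ ≥ 1`, `d ≥ 1`, `k ≥ 2`): `mem_cube_iff_coord`, `margin_one_eq` (`m₁ = m₂ + ρL`: the
  collar `□₁ ∖ □₂` is `ρL` fine sites thick); the witness pair `topCorner_mem_cubeFam` ∕ `shift_not_mem_cubeFam` ∕ `supDist_shift_le` ∕ `linfDist_shift_le` ∕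
  `natAbs_le_linfDist` (the top corner of `□₂` and its shift by `ρL + 1` along one axis); ★ `metricClause14_cubeFam_iff` (`MetricClause14 supDist (cubeFam …) k 1 L R M₁ ↔
  R·M₁ ≤ ρ`; (←) = r13's `metricClause14_cubeFam`), `le_margin_of_admissible134_cubeFam` (print's (1.3)–(1.4) at the tower forces `R·M₁ ≤ ρ`: p. 98's `ρ = R₁M₁` is sharp),
  ★ `sep22Zd_cubeFam_iff` (N06 currency, any `ZdIdx` datum `i` on the tower, truncation `2 ≤ m ≤ k`: `Sep22Zd R (memZd M′ i m) ↔ R·⌈M′⌉₊ ≤ ρ`; (←) by r05's `sep_cube`).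
* §1′ THE MINIMAL TYPED MARGIN `Ωₘᵢₙ`: `lo_mem_minTower_top` ∕ `drop_not_mem_minTower_top` ∕ `blockMap_drop_eq` (the fine corners of the level-`k` blocks `1` and `0` of one
  axis share every `M₁Lᵏ`-cube, `M₁ ≠ 1`), ★ `bigCubes14_minTower_iff` (`↔ M₁ = 1`), ★★ `admissible134_minTower_iff` (`↔ M₁ = 1 ∧ R ≤ L`), `domainSeq_minTower` (the TYPED
  law holds), ★ `sep22Zd_minTower_iff` (`↔ R·⌈M⌉₊ ≤ L`).
* §2 ON THE INDEX OF RECORD (`θ : Node00.Stage3Params`): `exists_idxB8SubD_minTower`, ★★ `exists_idxB8SubD_not_admissible134` (`2 ≤ M₁ ∨ θ.L + 1 ≤ R·M₁ → ∀ k ≥ 2,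
  ∃ j : IdxB8SubD θ` of depth `k` with `¬ Admissible134 θ.L M₁ R k Ω(j)`), ★★ `not_forall_idxB8SubD_admissible134`, ★ `exists_idxB8SubD_not_sep22Zd` (`θ.L + 1 ≤ R·⌈M⌉₊ →
  ∀ k ≥ 2, ∃ j` of depth `k` with `¬ Sep22Zd R (memZd M j k)`), `not_forall_idxB8SubD_sep22Zd`.
* §3 WHAT THE PRINT CLASS KEEPS: ★ `exists_idxB8SubD_admissible134` (`1 ≤ M₁ → θ.L ≤ R·M₁ → ∀ k ≥ 1, ∃ j : IdxB8SubD θ` of depth `k` with `Admissible134 θ.L M₁ R k Ω(j)` —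
  print's tower at margin `ρ = R·M₁`, corner and side multiples of `M₁`, r13's `admissible134_cubeFam_printed`): the print-class sub-family
  `{j : IdxB8SubD θ ∕∕ Admissible134 θ.L M₁ R j.k j.Ω}` is inhabited at every depth (NOT defined here — no `def` in a proof-lane file).

HONEST SCOPE.  Lattice bookkeeping (two explicit site pairs; `Int` floor division) over r05 ∕ r13's cube family and its landed admissibility lemmas, cited BY NAME; NO
estimate; nothing of Bałaban's asserted or refuted; NO landed theorem is false or weakened — the finding is about the STRENGTH of displayed hypotheses (a class-difference
certificate, not an unsatisfiability certificate: no binder is shown false, only demanded beyond print).  Count-neutral; N05 NOT discharged; K1⁹ NOT claimed; one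
finite 𝕋⁴ programme at fixed ε, Bałaban AS PRINTED; the Yang–Mills mass gap (Clay) is NOT proved by any of this — R4 closes the conditional finite-𝕋⁴ rung
`BalabanLadder.UV` only; nothing continuum ∕ ℝ⁴ ∕ OS.  Unit `pub-ymgap-dag-n05-w2` (g5), 2026-08-28.
-/

noncomputable section

namespace Literature.MathematicalPhysics.QuantumFieldTheory.Balaban1983to89.B8IdxB8SubDPrintClassGap

open B7Prop1Explicit B7Prop1Local
open Literature.MathematicalPhysics.QuantumLattice (blockMap)
open B8LeafModelZd (ZdIdx)
open B8ConstraintBonds (DomainSeq)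
open B8Eq131Cubes (cube cube_eq gs margin_succ)
open B8Eq131CubesAdmissible (cubeFam cubeFam_domainSeq cubeFam_true_zero cubeFam_of_pos cubeFam_of_lt sep_cube)
open B8SectAStatements (MetricClause14)
open B8Eq134Admissible (Admissible134 BigCubes14 supDist supDist_le_of_forall bigCubes14_cubeFam metricClause14_cubeFam admissible134_cubeFam)
open B9SupplySockB9P3ZdFrame (MemberZd memZd bigSideZd Sep22Zd)
open LatticeNorms (linfDist)
open B8IdxB8SubDRigidity (exists_idxB8SubD_cubeFam)
open Node00 (Stage3Params IdxB8SubD)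

-- `Site` alone could resolve to the torus sites of `Setup.lean`; re-export the `ℤ^d` sites of `B7Prop1Explicit`.
export B7Prop1Explicit (Site)

variable {d : ℕ}

/-! ## §1 Print's Sect.-F tower `cubeFam true L a M ρ k` = (ℤᵈ, □₁, …, □_k): the collar `□₁ ∖ □₂` is EXACTLY `ρL` fine sites thick -/

section CubeTower

variable {L : ℕ}

/-- Membership in a cube of the Sect.-F tower, coordinate-wise (`cube_eq`: corner `a`, side `M`, margin `m_j = Lʲρ(1 + … + L^{k−j})`). [cite: Balaban1985RegularSpaces, (1.131) p.99] -/
theorem mem_cube_iff_coord {a : Site d} {M ρ k j : ℕ} (hj : j ≤ k) (x : Site d) :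
    x ∈ cube L a M ρ k j ↔
      ∀ i, (L : ℤ) ^ k * a i - ((L ^ j * (ρ * gs L (k - j)) : ℕ) : ℤ) ≤ x i ∧
        x i ≤ (L : ℤ) ^ k * (a i + M) - 1 + ((L ^ j * (ρ * gs L (k - j)) : ℕ) : ℤ) := by
  rw [cube_eq hj]
  simp only [Set.mem_setOf_eq, InBox, B8Eq131Cubes.bLo, B8Eq131Cubes.bHi]

/-- The margin recursion across the first collar: `m₁ = m₂ + ρL` (`2 ≤ k`) — the collar `□₁ ∖ □₂` is exactly `ρL` fine sites = `ρ` level-`1` blocks thick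
(print: «a distance between boundaries of these cubes is equal to R₁M₁Lʲη», `ρ = R₁M₁`). [cite: Balaban1985RegularSpaces, p.98] -/
theorem margin_one_eq {ρ k : ℕ} (hk : 2 ≤ k) :
    ((L ^ 1 * (ρ * gs L (k - 1)) : ℕ) : ℤ) = ((L ^ 2 * (ρ * gs L (k - 2)) : ℕ) : ℤ) + (ρ : ℤ) * L := by
  have := margin_succ (L := L) (ρ := ρ) (show 1 < k by omega)
  rw [show (1 : ℕ) + 1 = 2 from rfl] at this
  rw [this]; push_cast; ring

/-- THE WITNESS PAIR ACROSS `□₁ ∖ □₂`, first point: the top corner of `□₂` lies in `□₂ = Ω₂` (`2 ≤ k`, `1 ≤ L`, `1 ≤ ρ`). [cite: Balaban1985RegularSpaces, (1.131) p.99] -/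
theorem topCorner_mem_cubeFam (hL : 1 ≤ L) (a : Site d) (M : ℕ) {ρ : ℕ} (hρ : 1 ≤ ρ) {k : ℕ} (hk : 2 ≤ k) :
    (fun i : Fin d => (L : ℤ) ^ k * (a i + M) - 1 + ((L ^ 2 * (ρ * gs L (k - 2)) : ℕ) : ℤ)) ∈ cubeFam true L a M ρ k 2 := by
  rw [cubeFam_of_pos true L a M ρ (by norm_num) hk, mem_cube_iff_coord hk]
  intro i
  refine ⟨?_, le_rfl⟩
  have hLk : (1 : ℤ) ≤ (L : ℤ) ^ k := by exact_mod_cast Nat.one_le_pow k L hL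
  have hμ : (1 : ℤ) ≤ ((L ^ 2 * (ρ * gs L (k - 2)) : ℕ) : ℤ) := by
    have h1 : 1 ≤ L ^ 2 * (ρ * gs L (k - 2)) := Nat.one_le_iff_ne_zero.mpr (by
      have := B8Eq131Cubes.one_le_gs L (k - 2); positivity)
    exact_mod_cast h1
  have hM : (0 : ℤ) ≤ (M : ℤ) := by positivity
  nlinarith

/-- The top corner of `□₂` shifted by `ρL + 1` along the axis `i₀` is NOT in `□₁ = Ω₁` (the collar is `ρL` fine sites thick). [cite: Balaban1985RegularSpaces, (1.131) p.99, p.98] -/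
theorem shift_not_mem_cubeFam (a : Site d) (M ρ : ℕ) {k : ℕ} (hk : 2 ≤ k) (i₀ : Fin d) :
    (fun i : Fin d => if i = i₀ then (L : ℤ) ^ k * (a i + M) - 1 + ((L ^ 2 * (ρ * gs L (k - 2)) : ℕ) : ℤ) + ((ρ : ℤ) * L + 1)
      else (L : ℤ) ^ k * (a i + M) - 1 + ((L ^ 2 * (ρ * gs L (k - 2)) : ℕ) : ℤ)) ∉ cubeFam true L a M ρ k 1 := by
  rw [cubeFam_of_pos true L a M ρ le_rfl (by omega), mem_cube_iff_coord (by omega)]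
  intro h
  have h2 := (h i₀).2
  simp only [if_true] at h2
  rw [margin_one_eq hk] at h2
  linarith

/-- The sup-distance of the witness pair is at most `ρL + 1` (r13's `ℝ`-valued `supDist` of (1.4)₃). [cite: Balaban1985RegularSpaces, (1.4) p.77 (bookkeeping)] -/
theorem supDist_shift_le (a : Site d) (M ρ k : ℕ) (i₀ : Fin d) :
    supDist
      (fun i : Fin d => if i = i₀ then (L : ℤ) ^ k * (a i + M) - 1 + ((L ^ 2 * (ρ * gs L (k - 2)) : ℕ) : ℤ) + ((ρ : ℤ) * L + 1)
        else (L : ℤ) ^ k * (a i + M) - 1 + ((L ^ 2 * (ρ * gs L (k - 2)) : ℕ) : ℤ))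
      (fun i : Fin d => (L : ℤ) ^ k * (a i + M) - 1 + ((L ^ 2 * (ρ * gs L (k - 2)) : ℕ) : ℤ)) ≤ ((ρ * L + 1 : ℕ) : ℝ) := by
  apply supDist_le_of_forall
  intro i
  by_cases hi : i = i₀
  · simp only [hi, if_true, add_sub_cancel_left]
    rw [show ((ρ : ℤ) * L + 1) = ((ρ * L + 1 : ℕ) : ℤ) by push_cast; ring, Int.natAbs_natCast]
  · simp [hi]

/-- The same bound for the `ℕ`-valued sup-distance `LatticeNorms.linfDist` of dag-n06-e's `ℤᵈ` frame ([B6] (2.2)). [cite: Balaban1984PropagatorsII, (2.2) p.224 (bookkeeping)] -/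
theorem linfDist_shift_le (a : Site d) (M ρ k : ℕ) (i₀ : Fin d) :
    linfDist
      (fun i : Fin d => if i = i₀ then (L : ℤ) ^ k * (a i + M) - 1 + ((L ^ 2 * (ρ * gs L (k - 2)) : ℕ) : ℤ) + ((ρ : ℤ) * L + 1)
        else (L : ℤ) ^ k * (a i + M) - 1 + ((L ^ 2 * (ρ * gs L (k - 2)) : ℕ) : ℤ))
      (fun i : Fin d => (L : ℤ) ^ k * (a i + M) - 1 + ((L ^ 2 * (ρ * gs L (k - 2)) : ℕ) : ℤ)) ≤ ρ * L + 1 := by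
  unfold linfDist
  apply Finset.sup_le
  intro i _
  by_cases hi : i = i₀
  · simp only [hi, if_true, add_sub_cancel_left]
    rw [show ((ρ : ℤ) * L + 1) = ((ρ * L + 1 : ℕ) : ℤ) by push_cast; ring, Int.natAbs_natCast]
  · simp [hi]

/-- A coordinate lower bound on `linfDist`: `|z i − z' i| ≤ linfDist z z'`. [cite: Balaban1984PropagatorsII, (2.2) p.224 (bookkeeping)] -/
theorem natAbs_le_linfDist (z z' : Site d) (i : Fin d) : (z i - z' i).natAbs ≤ linfDist z z' :=
  Finset.le_sup (f := fun μ => (z μ - z' μ).natAbs) (Finset.mem_univ i)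

/-! ### Print's metric clause and [B6] (2.2) at the Sect.-F tower: both hold IFF the separation constant is at most the margin `ρ` -/

/-- ★ **(1.4)₃ AT PRINT'S SECT.-F TOWER HOLDS IFF `R·M₁ ≤ ρ`** (`k ≥ 2`, `ρ ≥ 1`): the scaled sup-distance `(Lʲη)⁻¹dist(Ω_jᶜ, Ω_{j+1})` across `□₁ ∖ □₂` is `ρ + L⁻¹ < ρ + 1`
(the witness pair), so the clause fails for every `R·M₁ ≥ ρ + 1`; for `R·M₁ ≤ ρ` it is r13's `metricClause14_cubeFam` (p. 98: print takes `ρ = R₁M₁` exactly).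
[cite: Balaban1985RegularSpaces, (1.4) p.77, p.98] -/
theorem metricClause14_cubeFam_iff (hd : 0 < d) (hL : 1 ≤ L) (a : Site d) (M : ℕ) {ρ : ℕ} (hρ : 1 ≤ ρ) {k : ℕ} (hk : 2 ≤ k) (R M₁ : ℕ) :
    MetricClause14 supDist (cubeFam true L a M ρ k) k 1 L R M₁ ↔ R * M₁ ≤ ρ := by
  constructor
  · intro h
    by_contra hRM
    have hRM' : (ρ : ℝ) + 1 ≤ (R : ℝ) * M₁ := by exact_mod_cast (show ρ + 1 ≤ R * M₁ by omega)
    have hcl := h 1 (by omega) _ (shift_not_mem_cubeFam a M ρ hk ⟨0, hd⟩) _ (topCorner_mem_cubeFam hL a M hρ hk)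
    have hsd := supDist_shift_le (L := L) a M ρ k ⟨0, hd⟩
    have hL0 : (0 : ℝ) < (L : ℝ) := by exact_mod_cast hL
    rw [pow_one, mul_one] at hcl
    have key : ∀ S : ℝ, S ≤ ((ρ * L + 1 : ℕ) : ℝ) → (R : ℝ) * M₁ < ((L : ℝ))⁻¹ * S → False := by
      intro S hS hlt
      have hb : ((L : ℝ))⁻¹ * S ≤ (ρ : ℝ) + 1 := by
        calc ((L : ℝ))⁻¹ * S ≤ ((L : ℝ))⁻¹ * ((ρ * L + 1 : ℕ) : ℝ) := mul_le_mul_of_nonneg_left hS (inv_nonneg.mpr hL0.le)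
          _ ≤ (ρ : ℝ) + 1 := by
              rw [inv_mul_le_iff₀ hL0]; push_cast
              have : (1 : ℝ) ≤ L := by exact_mod_cast hL
              have : (0 : ℝ) ≤ ρ := by positivity
              nlinarith
      linarith
    exact key _ hsd hcl
  · intro hRM
    exact metricClause14_cubeFam true hL a M k hRM

/-- Consequently print's literal (1.3)–(1.4) at the Sect.-F tower FORCES `R·M₁ ≤ ρ` (p. 98's `ρ = R₁M₁` is sharp). [cite: Balaban1985RegularSpaces, (1.3)–(1.4) p.77, p.98] -/
theorem le_margin_of_admissible134_cubeFam (hd : 0 < d) (hL : 1 ≤ L) (a : Site d) (M : ℕ) {ρ : ℕ} (hρ : 1 ≤ ρ) {k : ℕ} (hk : 2 ≤ k)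
    {R M₁ : ℕ} (h : Admissible134 L M₁ R k (cubeFam true L a M ρ k)) : R * M₁ ≤ ρ :=
  (metricClause14_cubeFam_iff hd hL a M hρ hk R M₁).1 h.metric

/-- ★ **[B6] (2.2) AT PRINT'S SECT.-F TOWER, IN dag-n06-e's `ℤᵈ` FRAME, HOLDS IFF `R·⌈M′⌉₊ ≤ ρ`**: for every `ZdIdx` datum `i` whose domain sequence is the tower and every
truncation `2 ≤ m ≤ k`, `Sep22Zd R (memZd M′ i m) ↔ R·⌈M′⌉₊ ≤ ρ` — the witness pair across `□₁ ∖ □₂` (sup-distance `ρL + 1`) for (→), r05's `sep_cube` (every pair across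
`□_j ∖ □_{j+1}` is more than `ρLʲ` apart in one coordinate) for (←) — the `top = true` (`Ω₀ = ℤᵈ`) IFF-sibling of dag-n06-w2's `B9BlockLawsCubeMemberZd.sep22_cube`.
[cite: Balaban1984PropagatorsII, (2.2) p.224; Balaban1985BackgroundPropagators, p.399 («M and R sufficiently large»); Balaban1985RegularSpaces, p.98] -/
theorem sep22Zd_cubeFam_iff (hd : 0 < d) (hL : 1 ≤ L) {a : Site d} {M ρ k : ℕ} (hρ : 1 ≤ ρ) (i : ZdIdx d L) (hΩ : i.Ω = cubeFam true L a M ρ k)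
    {m : ℕ} (hm2 : 2 ≤ m) (hmk : m ≤ k) (M' : ℝ) (R : ℕ) :
    Sep22Zd R (memZd M' i m) ↔ R * ⌈M'⌉₊ ≤ ρ := by
  constructor
  · intro h
    by_contra hRM
    have hRM' : ρ + 1 ≤ R * ⌈M'⌉₊ := by omega
    have hcl := h 1 (by simpa [memZd] using hm2) _ (by simpa [memZd, hΩ] using shift_not_mem_cubeFam (L := L) a M ρ (show 2 ≤ k by omega) ⟨0, hd⟩)
      _ (by simpa [memZd, hΩ] using topCorner_mem_cubeFam hL a M hρ (show 2 ≤ k by omega))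
    have hle := linfDist_shift_le (L := L) a M ρ k ⟨0, hd⟩
    simp only [memZd, bigSideZd, pow_one] at hcl
    have h1 : (ρ + 1) * L ≤ R * ⌈M'⌉₊ * L := Nat.mul_le_mul_right L hRM'
    have h2 : R * (⌈M'⌉₊ * L) < ρ * L + 1 := lt_of_lt_of_le hcl hle
    nlinarith
  · intro hRM j hj z hz z' hz'
    simp only [memZd] at hj hz hz'
    rw [hΩ] at hz hz'
    rcases Nat.eq_zero_or_pos j with rfl | hj0
    · rw [cubeFam_true_zero] at hz
      exact absurd (Set.mem_univ _) hz
    · have hjk : j < k := by omega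
      rw [cubeFam_of_pos true L a M ρ hj0 hjk.le] at hz
      rw [cubeFam_of_pos true L a M ρ (by omega) (by omega)] at hz'
      obtain ⟨i₁, hi₁⟩ := sep_cube hjk hz hz'
      have hnat : ρ * L ^ j + 1 ≤ (z i₁ - z' i₁).natAbs := by
        have : (((z i₁ - z' i₁).natAbs : ℕ) : ℤ) = |z i₁ - z' i₁| := Int.natCast_natAbs _
        exact_mod_cast (show ((ρ * L ^ j + 1 : ℕ) : ℤ) ≤ ((z i₁ - z' i₁).natAbs : ℤ) by rw [this]; push_cast at hi₁ ⊢; linarith)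
      have hlinf := natAbs_le_linfDist z z' i₁
      simp only [memZd, bigSideZd]
      calc R * (⌈M'⌉₊ * L ^ j) = R * ⌈M'⌉₊ * L ^ j := by ring
        _ ≤ ρ * L ^ j := Nat.mul_le_mul_right _ hRM
        _ < ρ * L ^ j + 1 := Nat.lt_succ_self _
        _ ≤ linfDist z z' := hnat.trans hlinf

end CubeTower

/-! ## §1′ The minimal typed margin: `Ωₘᵢₙ(L, k) = cubeFam true L (fun _ ↦ L + 1) 1 L k` (side `1`, margin `ρ = L`, corner `L + 1`) -/

section MinTower

variable {L : ℕ}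

/-- The common fine corner `(Lᵏ, …, Lᵏ)` of the level-`k` block `(1, …, 1)` lies in `□_k` (it is its lower corner). [cite: Balaban1985RegularSpaces, (1.131) p.99] -/
theorem lo_mem_minTower_top (hL : 1 ≤ L) {k : ℕ} (hk : 1 ≤ k) :
    (fun _ : Fin d => (L : ℤ) ^ k) ∈ cubeFam true L (fun _ : Fin d => (L : ℤ) + 1) 1 L k k := by
  rw [cubeFam_of_pos true L _ 1 L hk le_rfl, mem_cube_iff_coord le_rfl]
  have hm : ((L ^ k * (L * gs L (k - k)) : ℕ) : ℤ) = (L : ℤ) ^ k * L := by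
    rw [Nat.sub_self, B8Eq131Cubes.gs_zero, mul_one]; push_cast; ring
  intro i
  rw [hm]
  have hLk : (1 : ℤ) ≤ (L : ℤ) ^ k := by exact_mod_cast Nat.one_le_pow k L hL
  have hL0 : (0 : ℤ) ≤ (L : ℤ) := by positivity
  push_cast
  constructor <;> nlinarith

/-- Dropping the coordinate `i₀` of that corner to `0` leaves `□_k` (below its lower corner `Lᵏ ≥ 1`). [cite: Balaban1985RegularSpaces, (1.131) p.99] -/
theorem drop_not_mem_minTower_top (hL : 1 ≤ L) {k : ℕ} (hk : 1 ≤ k) (i₀ : Fin d) :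
    (fun i : Fin d => if i = i₀ then (0 : ℤ) else (L : ℤ) ^ k) ∉ cubeFam true L (fun _ : Fin d => (L : ℤ) + 1) 1 L k k := by
  rw [cubeFam_of_pos true L _ 1 L hk le_rfl, mem_cube_iff_coord le_rfl]
  intro h
  have h1 := (h i₀).1
  simp only [if_true] at h1
  have hm : ((L ^ k * (L * gs L (k - k)) : ℕ) : ℤ) = (L : ℤ) ^ k * L := by
    rw [Nat.sub_self, B8Eq131Cubes.gs_zero, mul_one]; push_cast; ring
  rw [hm] at h1
  have hLk : (1 : ℤ) ≤ (L : ℤ) ^ k := by exact_mod_cast Nat.one_le_pow k L hL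
  nlinarith

/-- For `M₁ ≠ 1` the two corners share their `M₁Lᵏ`-cube label (`⌊Lᵏ∕(M₁Lᵏ)⌋ = 0 = ⌊0∕(M₁Lᵏ)⌋`, `M₁ ≥ 2`; `blockMap 0` is constant). [cite: Balaban1985RegularSpaces, (1.4) p.77] -/
theorem blockMap_drop_eq (hL : 1 ≤ L) {k M₁ : ℕ} (hM₁ : M₁ ≠ 1) (i₀ : Fin d) :
    blockMap (M₁ * L ^ k) (fun _ : Fin d => (L : ℤ) ^ k) = blockMap (M₁ * L ^ k) (fun i : Fin d => if i = i₀ then (0 : ℤ) else (L : ℤ) ^ k) := by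
  funext i
  simp only [blockMap]
  by_cases hi : i = i₀
  · simp only [hi, if_true, Int.zero_ediv]
    rcases Nat.eq_zero_or_pos M₁ with h0 | hpos
    · subst h0; simp
    · have h2 : 2 ≤ M₁ := by omega
      apply Int.ediv_eq_zero_of_lt (by positivity)
      have hLk : (0 : ℤ) < (L : ℤ) ^ k := by positivity
      push_cast
      nlinarith
  · simp [hi]

/-- ★ **(1.4)₂ AT THE MINIMAL-MARGIN TOWER HOLDS IFF `M₁ = 1`**: «Ω_j is a sum of cubes of a size M₁Lʲη» fails at the top level for every `M₁ ≥ 2` (and for the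
degenerate `M₁ = 0`), and holds for `M₁ = 1` (= `Lʲ`-block saturation, r13's `bigCubes14_cubeFam`). [cite: Balaban1985RegularSpaces, (1.4) p.77, (1.131) p.99] -/
theorem bigCubes14_minTower_iff (hd : 0 < d) (hL : 1 ≤ L) {k : ℕ} (hk : 1 ≤ k) (M₁ : ℕ) :
    BigCubes14 L M₁ (cubeFam true L (fun _ : Fin d => (L : ℤ) + 1) 1 L k) ↔ M₁ = 1 := by
  constructor
  · intro h
    by_contra hM₁
    exact drop_not_mem_minTower_top hL hk ⟨0, hd⟩
      (h k _ _ (blockMap_drop_eq hL hM₁ ⟨0, hd⟩) (lo_mem_minTower_top hL hk))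
  · rintro rfl
    exact bigCubes14_cubeFam true hL _ 1 k le_rfl (one_dvd _) (fun _ => one_dvd _) (one_dvd _)

/-- ★★ **PRINT'S (1.3)–(1.4) AT THE MINIMAL-MARGIN TOWER HOLDS IFF `M₁ = 1 ∧ R ≤ L`** (`k ≥ 2`) — exactly the regime print EXCLUDES («M₁ … much bigger than δ₀⁻¹»,
«R … a sufficiently large positive integer (a power of L)»), although the tower is a `DomainSeq` (`cubeFam_domainSeq` at `ρ = L`) and hence (§2) the domain sequence of
a member of the leaf index of record at every depth. [cite: Balaban1985RegularSpaces, (1.3)–(1.4) p.77, (1.131) p.99] -/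
theorem admissible134_minTower_iff (hd : 0 < d) (hL : 1 ≤ L) {k : ℕ} (hk : 2 ≤ k) (R M₁ : ℕ) :
    Admissible134 L M₁ R k (cubeFam true L (fun _ : Fin d => (L : ℤ) + 1) 1 L k) ↔ M₁ = 1 ∧ R ≤ L := by
  constructor
  · intro h
    have hM₁ : M₁ = 1 := (bigCubes14_minTower_iff hd hL (by omega) M₁).1 h.bigCubes
    have hRM : R * M₁ ≤ L := (metricClause14_cubeFam_iff hd hL _ 1 hL hk R M₁).1 h.metric
    rw [hM₁, mul_one] at hRM
    exact ⟨hM₁, hRM⟩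
  · rintro ⟨rfl, hR⟩
    exact admissible134_cubeFam true hL _ 1 le_rfl k le_rfl (one_dvd _) (fun _ => one_dvd _) (one_dvd _) (by simpa using hR)

/-- The minimal-margin tower IS admissible in the TYPED sense (`B8ConstraintBonds.DomainSeq`; `cubeFam_domainSeq` at `ρ = L`). [cite: Balaban1985RegularSpaces, (1.3)–(1.4) p.77] -/
theorem domainSeq_minTower (hL : 1 ≤ L) (k : ℕ) : DomainSeq L (cubeFam true L (fun _ : Fin d => (L : ℤ) + 1) 1 L k) := cubeFam_domainSeq true hL _ 1 le_rfl k

/-- ★ [B6] (2.2) at the minimal-margin tower holds iff `R·⌈M⌉₊ ≤ L` (`sep22Zd_cubeFam_iff` at `ρ = L`). [cite: Balaban1984PropagatorsII, (2.2) p.224] -/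
theorem sep22Zd_minTower_iff (hd : 0 < d) (hL : 1 ≤ L) {k : ℕ} (i : ZdIdx d L) (hΩ : i.Ω = cubeFam true L (fun _ : Fin d => (L : ℤ) + 1) 1 L k)
    {m : ℕ} (hm2 : 2 ≤ m) (hmk : m ≤ k) (M : ℝ) (R : ℕ) :
    Sep22Zd R (memZd M i m) ↔ R * ⌈M⌉₊ ≤ L :=
  sep22Zd_cubeFam_iff hd hL hL i hΩ hm2 hmk M R

end MinTower

/-! ## §2 On the (1.5)-keyed leaf index of record `IdxB8SubD θ` -/

section Index

variable (θ : Stage3Params)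

/-- `1 ≤ θ.L` (Bałaban's block size is odd `> 1`; private plumbing). [folklore] -/
private theorem one_le_L : 1 ≤ θ.L := le_trans (by norm_num) θ.two_le_L

/-- `0 < θ.D` (`D = d₆ + 1`; private plumbing). [folklore] -/
private theorem D_pos : 0 < θ.D := by rw [← θ.hd₆]; exact Nat.succ_pos _

/-- The minimal-margin tower is the domain sequence of a member of the index of record at every depth `k ≥ 1` (this seat's g4 `exists_idxB8SubD_cubeFam` at
corner `L + 1`, side `1`, margin `ρ = L`, spacing `L⁻ᵏ`). [cite: Balaban1985RegularSpaces, (1.131) p.99, (1.3)–(1.5) p.77] -/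
theorem exists_idxB8SubD_minTower {k : ℕ} (hk : 1 ≤ k) :
    ∃ j : IdxB8SubD θ, j.1.1.1.1.k = k ∧ j.1.1.1.1.Ω = cubeFam true θ.L (fun _ : Fin θ.D => (θ.L : ℤ) + 1) 1 θ.L k := by
  obtain ⟨j, -, hk', hΩ, -⟩ := exists_idxB8SubD_cubeFam θ (fun _ => (θ.L : ℤ) + 1) 1 le_rfl hk
  exact ⟨j, hk', hΩ⟩

/-- ★★ **THE INDEX OF RECORD IS STRICTLY WIDER THAN PRINT'S (1.3)–(1.4) FOR EVERY CHOICE OF PRINT'S CONSTANTS**: for every `M₁ ≥ 2`, or every `(R, M₁)` with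
`R·M₁ ≥ L + 1`, and every depth `k ≥ 2`, some member of `IdxB8SubD θ` of depth `k` violates `Admissible134 θ.L M₁ R k` (§1 at the minimal-margin tower).
[cite: Balaban1985RegularSpaces, (1.3)–(1.4) p.77 («M₁ … much bigger than δ₀⁻¹», «R … a sufficiently large positive integer (a power of L)»), (1.131) p.99] -/
theorem exists_idxB8SubD_not_admissible134 {M₁ R : ℕ} (h : 2 ≤ M₁ ∨ θ.L + 1 ≤ R * M₁) {k : ℕ} (hk : 2 ≤ k) :
    ∃ j : IdxB8SubD θ, j.1.1.1.1.k = k ∧ ¬ Admissible134 θ.L M₁ R k j.1.1.1.1.Ω := by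
  obtain ⟨j, hjk, hΩ⟩ := exists_idxB8SubD_minTower θ (show 1 ≤ k by omega)
  refine ⟨j, hjk, fun hA => ?_⟩
  rw [hΩ] at hA
  obtain ⟨hM₁, hR⟩ := (admissible134_minTower_iff (D_pos θ) (one_le_L θ) hk R M₁).1 hA
  subst hM₁
  rcases h with h | h <;> omega

/-- ★★ **PRINT'S (1.3)–(1.4) IS NOT A LAW OF THE INDEX OF RECORD** (read at each member's own depth), for any print-regime constants.
[cite: Balaban1985RegularSpaces, (1.3)–(1.4) p.77] -/
theorem not_forall_idxB8SubD_admissible134 {M₁ R : ℕ} (h : 2 ≤ M₁ ∨ θ.L + 1 ≤ R * M₁) :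
    ¬ ∀ j : IdxB8SubD θ, Admissible134 θ.L M₁ R j.1.1.1.1.k j.1.1.1.1.Ω := by
  intro hall
  obtain ⟨j, hjk, hj⟩ := exists_idxB8SubD_not_admissible134 θ h (le_refl 2)
  exact hj (hjk ▸ hall j)

/-- ★ **[B6] (2.2) FAILS ON THE INDEX OF RECORD FOR EVERY `R·⌈M⌉₊ ≥ L + 1`**: at every depth `k ≥ 2` some member `j` of `IdxB8SubD θ` has
`¬ Sep22Zd R (memZd M j k)` at its top truncation — the regime of N06's member-uniform suppliers (`Sep22Zd R` with `R⌈M⌉` large) does not cover the index.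
[cite: Balaban1984PropagatorsII, (2.2) p.224; Balaban1985BackgroundPropagators, p.399 («M and R sufficiently large»)] -/
theorem exists_idxB8SubD_not_sep22Zd {M : ℝ} {R : ℕ} (h : θ.L + 1 ≤ R * ⌈M⌉₊) {k : ℕ} (hk : 2 ≤ k) :
    ∃ j : IdxB8SubD θ, j.1.1.1.1.k = k ∧ ¬ Sep22Zd R (memZd M j.1.1.1.1 k) := by
  obtain ⟨j, hjk, hΩ⟩ := exists_idxB8SubD_minTower θ (show 1 ≤ k by omega)
  refine ⟨j, hjk, fun hS => ?_⟩
  have := (sep22Zd_minTower_iff (D_pos θ) (one_le_L θ) j.1.1.1.1 hΩ hk le_rfl M R).1 hS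
  omega

/-- [B6] (2.2) at the top truncation is NOT a law of the index of record, for any `R·⌈M⌉₊ ≥ L + 1`. [cite: Balaban1984PropagatorsII, (2.2) p.224] -/
theorem not_forall_idxB8SubD_sep22Zd {M : ℝ} {R : ℕ} (h : θ.L + 1 ≤ R * ⌈M⌉₊) :
    ¬ ∀ j : IdxB8SubD θ, Sep22Zd R (memZd M j.1.1.1.1 j.1.1.1.1.k) := by
  intro hall
  obtain ⟨j, hjk, hj⟩ := exists_idxB8SubD_not_sep22Zd θ h (le_refl 2)
  exact hj (hjk ▸ hall j)

end Index

/-! ## §3 What the print class keeps: print-admissible members at every depth -/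

section PrintClass

variable (θ : Stage3Params)

/-- ★ **THE PRINT-CLASS SUB-FAMILY `{j : IdxB8SubD θ ∕∕ Admissible134 θ.L M₁ R j.k j.Ω}` IS INHABITED AT EVERY DEPTH**: for `1 ≤ M₁`, `L ≤ R·M₁` and `k ≥ 1`,
print's Sect.-F tower with separation `ρ = R·M₁`, corner `M₁` and side `M₁` (both multiples of `M₁`) is a member of the index of record of depth `k` satisfying
print's literal (1.3)–(1.4) (r13's `admissible134_cubeFam_printed` + this seat's g4 `exists_idxB8SubD_cubeFam`).
[cite: Balaban1985RegularSpaces, (1.3)–(1.4) p.77, (1.131) p.99, p.98 («M a multiple of R₁M₁», «ρ = R₁M₁»)] -/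
theorem exists_idxB8SubD_admissible134 {M₁ R : ℕ} (hM₁ : 1 ≤ M₁) (hRM : θ.L ≤ R * M₁) {k : ℕ} (hk : 1 ≤ k) :
    ∃ j : IdxB8SubD θ, j.1.1.1.1.k = k ∧ Admissible134 θ.L M₁ R k j.1.1.1.1.Ω := by
  have hL : 1 ≤ θ.L := le_trans (by norm_num) θ.two_le_L
  obtain ⟨j, -, hk', hΩ, -⟩ := exists_idxB8SubD_cubeFam θ (fun _ => (M₁ : ℤ)) M₁ hRM hk
  refine ⟨j, hk', ?_⟩
  rw [hΩ]
  exact B8Eq134Admissible.admissible134_cubeFam_printed true hL _ M₁ k hM₁ hRM (fun _ => dvd_rfl) dvd_rfl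

end PrintClass

end Literature.MathematicalPhysics.QuantumFieldTheory.Balaban1983to89.B8IdxB8SubDPrintClassGap

end
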